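import Summits.ValiantsHypothesis.ValiantsHypothesis.Theses.BoolTransfer
import Literature.Computability.AlgebraicComplexity.SharpPBitsPPoly
import Literature.Computability.Complexity.CountingProofs

/-!
# Route BoolTransfer — glue items `Assembly` (stmt-ValiantsHypothesis-10620), `ConstElimGlue`
# (stmt-ValiantsHypothesis-1388), `CharTransferGlue` (stmt-ValiantsHypothesis-1403)

Three bookkeeping items of route `BoolTransfer` with candidate proofs on file since the route review
of 2026-08-15 (refuter `Glue.lean`, rc 0) and never landed (Theorems/ is prover-only):
* `assembly_proof` — `BoolGrhFree → BoolNpPpoly → ValiantsHypothesis`: if `VP ℂ = VNP ℂ` then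
  `NP ⊆ P/poly` (`BoolGrhFree`), contradicting `BoolNpPpoly`; pure logic (`ValiantsHypothesis`
  unfolds to `VP ℂ ≠ VNP ℂ`).
* `constElimGlue_proof` — `TauConstElim → BoolGrhFree`: `VP = VNP` gives `τ(per_n)` p-bounded
  (`TauConstElim`), hence `P^{#P} ⊆ P/poly` (tree: `PSharpP_subset_PPoly_of_isPBounded_perPoly`,
  Bürgisser's Lemma 2.12), and `NP ⊆ P^{#P}` (tree: `NP_subset_PSharpP_holds`).
* `charTransferGlue_proof` — `BoolCharTransfer → FpBarCollapse → BoolGrhFree`: `VP = VNP` over `ℂ`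
  transfers to `𝔽̄_p` for all large primes `p` (`BoolCharTransfer`); pick one (infinitely many primes)
  and apply `FpBarCollapse`.
Honest framing: implications between OPEN route statements; nothing here is progress on `VP ≠ VNP`.
-/

set_option linter.dupNamespace false

namespace Summit.ValiantsHypothesis.ValiantsHypothesis.Theorems.BoolTransfer

open Literature.Computability.AlgebraicComplexity Literature.Computability.Complexity
open Summit.ValiantsHypothesis.ValiantsHypothesis.Theses.BoolTransfer

/-- **Item `Assembly` (stmt-ValiantsHypothesis-10620), PROVED**: `BoolGrhFree → BoolNpPpoly → VP_ℂ ≠ VNP_ℂ`.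
[folklore] -/
theorem assembly_proof : Assembly :=
  fun hG hN hV => hN (hG hV)

/-- **Item `ConstElimGlue` (stmt-ValiantsHypothesis-1388), PROVED**: `TauConstElim → BoolGrhFree`
(`τ(per)` p-bounded ⇒ `P^{#P} ⊆ P/poly` ⊇ `NP`). [cite: Burgisser2009, Lemma 2.12] -/
theorem constElimGlue_proof : ConstElimGlue :=
  fun hT hV _L hL => PSharpP_subset_PPoly_of_isPBounded_perPoly (hT hV) (NP_subset_PSharpP_holds hL)

/-- **Item `CharTransferGlue` (stmt-ValiantsHypothesis-1403), PROVED**: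
`BoolCharTransfer → FpBarCollapse → BoolGrhFree` (choose a prime beyond the eventual threshold).
[folklore] -/
theorem charTransferGlue_proof : CharTransferGlue := by
  intro hT hC hV
  obtain ⟨N, hN⟩ := Filter.eventually_atTop.1 (hT hV)
  obtain ⟨p, hpN, hp⟩ := Nat.exists_infinite_primes N
  haveI : Fact p.Prime := ⟨hp⟩
  exact hC p (hN p hpN)

end Summit.ValiantsHypothesis.ValiantsHypothesis.Theorems.BoolTransfer
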